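import Literature.Topology.FourManifolds.SPC4HandlesLeaves
import Literature.Topology.FourManifolds.SPC4HandlesNormalFormProofs
import Literature.Topology.FourManifolds.BalancedPresentationBasisChangeProofs
import HarnessLib

/-!
# Laudenbach–Poénaru's Lemma 2 (h₁) from the current leaves of its proof DAG

Topic `Literature/Topology/FourManifolds`; fact seat
`provefact-Literature.Topology.FourManifolds.lauden-f709dd520c` on the named fact **h₁**
`Literature.Topology.FourManifolds.laudenbachPoenaru_exists_diffeoExtends_mapOfEq_eq`
(`SPC4HandlesProofs.lean`): *for every compact connected orientable smooth `4`-dimensional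
`1`-handlebody `V`, every boundary datum `b` and every base point `z₀` of its boundary manifold,
each automorphism of `π₁(b.carrier, z₀)` is induced by a self-diffeomorphism of `b.carrier`
fixing `z₀` that extends over `V`* — Laudenbach–Poénaru, Bull. SMF 100 (1972), §2, Lemma 2
(pp. 339–340): *"`B : Diff(Y_p, x₀) → Aut π₁(∂Y_p, x₀)` is surjective"*, transported from the
model `Y_p = ♮p S¹ × D³` to an arbitrary `V`.

This file only **assembles**; nothing is asserted, no definition and no named fact is
introduced.  The tree proves h₁ from four inputs
(`laudenbachPoenaru_exists_diffeoExtends_mapOfEq_eq_of_nielsen`, `SPC4HandlesNielsenReduction.lean`):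
the normal form NORM (`exists_hasHandleDecomposition_handleCount_one`), the classification UNIQ₄
(`nonempty_diffeomorph_of_hasHandleDecomposition_handleCount_one`), Nielsen's theorem NIELSEN
(`autFreeGroup_eq_closure_nielsen`) and the realisation REALISE of the paper's three generators
`Φ₁, Φ₂, Φ₃` by extendable based diffeomorphisms of the model
(`exists_oneHandlebody_realise_laudenbachPoenaruGenerators`).  Of these, NIELSEN is now a theorem
(`autFreeGroup_eq_closure_nielsen_holds`, `BalancedPresentationBasisChangeProofs.lean`); UNIQ₄
follows from the uniqueness of attaching one `1`-handle L1 alone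
(`nonempty_diffeomorph_of_hasHandleDecomposition_handleCount_one_of_oneHandle`,
`SPC4HandlesLeaves.lean`, the `0`-handle being a disc by `MorseDiscLemma.lean`); and NORM follows
from the one leaf of Milnor's proof DAG of the First Cancellation Theorem 5.4 that is still a
named fact, the deformation of the level diffeomorphism `h` in the general case of Assertion 6
(`exists_hasHandleDecomposition_handleCount_one_of_levelDeformation`,
`SPC4HandlesNormalFormProofs.lean`).  Hence h₁ is a consequence of exactly **three leaves that
are still named facts**:

| leaf | source | tree name |
|---|---|---|
| Assertion 6 of Thm. 5.4, the deformation of `h` | Milnor (1965), proof of Thm. 5.4 (PDF pp. 31–32) | `Cobordism.Milnor1965_cancellation_levelDeformation` |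
| L1, uniqueness of attaching one `1`-handle | Kosinski (1993), VI (6.6), (11.4)(c) | `oneHandle_nonempty_diffeomorph` |
| REALISE, the diffeomorphisms `H₁, H₂, H₃` | Laudenbach–Poénaru (1972), proof of Lemma 2 (pp. 339–340) | `exists_oneHandlebody_realise_laudenbachPoenaruGenerators` |

Main statements: `laudenbachPoenaru_exists_diffeoExtends_mapOfEq_eq_of_norm_of_oneHandle_of_realise`
(NORM + L1 + REALISE) and `laudenbachPoenaru_exists_diffeoExtends_mapOfEq_eq_of_leaves`
(Assertion 6 + L1 + REALISE).  Once `Cobordism.Milnor1965_cancellation_levelDeformation_holds`,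
`oneHandle_nonempty_diffeomorph_holds` and
`exists_oneHandlebody_realise_laudenbachPoenaruGenerators_holds` have landed, the discharge
`laudenbachPoenaru_exists_diffeoExtends_mapOfEq_eq_holds` is
`laudenbachPoenaru_exists_diffeoExtends_mapOfEq_eq_of_leaves` applied to them.

## References

* F. Laudenbach, V. Poénaru, *A note on 4-dimensional handlebodies*, Bull. Soc. Math. France
  100 (1972), 337–344: §2, p. 339 (the basis `x₁, …, x_p`, `i_#` bijective, Lemma 2 and its
  reduction to `H₁, H₂, H₃`), p. 340 (the slide defining `H₃`).  Held:
  `lit read doi-10-24033-bsmf-1741`, PDF pp. 3–5. [LaudenbachPoenaruBSMF1972]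
* J. Milnor, *Lectures on the h-cobordism theorem*, notes by L. Siebenmann and J. Sondow,
  Princeton Mathematical Notes (1965): Thm. 5.4 and its proof, Assertion 6 (PDF pp. 27–32);
  proof of Thm. 8.1 Index 0 (PDF p. 54). [MilnorHCobordism1965]
* A. A. Kosinski, *Differential Manifolds*, Academic Press (1993), VI (6.6), §11, (11.4)(c).
  [Kosinski1993]
* J. Nielsen, *Die Isomorphismengruppe der freien Gruppen*, Math. Ann. 91 (1924), 169–209;
  D. L. Johnson, *Presentations of Groups*, 2nd ed. (1997), Ch. 3 §4, Cor. 7. [Johnson1997]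
-/

open scoped Manifold ContDiff Topology
open Set Function

noncomputable section

namespace Literature.Topology.FourManifolds

universe u

/-- **h₁ from NORM, L1 and REALISE** (Nielsen's theorem being discharged): Laudenbach–Poénaru's
Lemma 2 for every compact connected orientable `4`-dimensional `1`-handlebody
(`laudenbachPoenaru_exists_diffeoExtends_mapOfEq_eq`) follows from the normal form NORM
(`exists_hasHandleDecomposition_handleCount_one`), the uniqueness of attaching one `1`-handle L1
(`oneHandle_nonempty_diffeomorph`, giving UNIQ₄ by
`nonempty_diffeomorph_of_hasHandleDecomposition_handleCount_one_of_oneHandle`) and the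
realisation of `Φ₁, Φ₂, Φ₃` on the model
(`exists_oneHandlebody_realise_laudenbachPoenaruGenerators`), by
`laudenbachPoenaru_exists_diffeoExtends_mapOfEq_eq_of_nielsen` fed with
`autFreeGroup_eq_closure_nielsen_holds`.
[cite: LaudenbachPoenaruBSMF1972, §2, Lemma 2 and its proof (pp. 339–340)]
[cite: Kosinski1993, VI (6.6), (11.4)(c)] [cite: Johnson1997, Ch. 3 §4 Cor. 7] -/
theorem laudenbachPoenaru_exists_diffeoExtends_mapOfEq_eq_of_norm_of_oneHandle_of_realise
    (hNo : exists_hasHandleDecomposition_handleCount_one.{u})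
    (hL : oneHandle_nonempty_diffeomorph.{u})
    (hR : exists_oneHandlebody_realise_laudenbachPoenaruGenerators.{u}) :
    laudenbachPoenaru_exists_diffeoExtends_mapOfEq_eq.{u} :=
  laudenbachPoenaru_exists_diffeoExtends_mapOfEq_eq_of_nielsen hNo
    (nonempty_diffeomorph_of_hasHandleDecomposition_handleCount_one_of_oneHandle hL)
    autFreeGroup_eq_closure_nielsen_holds hR

/-- **h₁ from the three current leaves of its proof DAG**: Laudenbach–Poénaru's Lemma 2 for
every compact connected orientable `4`-dimensional `1`-handlebody
(`laudenbachPoenaru_exists_diffeoExtends_mapOfEq_eq`) follows from the deformation of Milnor's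
level diffeomorphism `h` in the general case of Assertion 6 of the proof of Thm. 5.4
(`Cobordism.Milnor1965_cancellation_levelDeformation`, giving NORM by
`exists_hasHandleDecomposition_handleCount_one_of_levelDeformation`), the uniqueness of
attaching one `1`-handle L1 (`oneHandle_nonempty_diffeomorph`) and the realisation of
`Φ₁, Φ₂, Φ₃` on the model (`exists_oneHandlebody_realise_laudenbachPoenaruGenerators`).
[cite: LaudenbachPoenaruBSMF1972, §2, Lemma 2 and its proof (pp. 339–340)]
[cite: MilnorHCobordism1965, proof of Thm. 5.4, Assertion 6 (PDF pp. 31–32); proof of Thm. 8.1 Index 0 (PDF p. 54)]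
[cite: Kosinski1993, VI (6.6), (11.4)(c)] -/
theorem laudenbachPoenaru_exists_diffeoExtends_mapOfEq_eq_of_leaves
    (hD : Cobordism.Milnor1965_cancellation_levelDeformation.{u})
    (hL : oneHandle_nonempty_diffeomorph.{u})
    (hR : exists_oneHandlebody_realise_laudenbachPoenaruGenerators.{u}) :
    laudenbachPoenaru_exists_diffeoExtends_mapOfEq_eq.{u} :=
  laudenbachPoenaru_exists_diffeoExtends_mapOfEq_eq_of_norm_of_oneHandle_of_realise
    (exists_hasHandleDecomposition_handleCount_one_of_levelDeformation hD) hL hR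

end Literature.Topology.FourManifolds

end
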